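import Literature.NumberTheory.EllipticCurves.KubotaLeopoldtTwoNumerator
import Summits.BirchSwinnertonDyer.Rank1Residual.X1.MuLambdaAlgebra
import HarnessLib

/-!
# Route `EisensteinDepletionAtTwo`, crux E1M `DepletedLambdaLawAtTwoMod` (item stmt-BirchSwinnertonDyer-20341),
# line `star` (registered skeleton sha16 84cd5bd2ff46, lead `bsd-rank2-star-p1`) — STUB (K) `KlTwoWitness` CLOSED over
# tree names: the Kubota–Leopoldt witnesses at `2`

Cell `bsd-rank2` (run/shared/lean/pub/bsd-rank2/), seat `bsd-rank2-eng-2` GEN 7. THEOREMS ONLY — no definition, no named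
fact, nothing conditional; route-independent (no Theses import). HONEST FRAMING: (K) is bookkeeping on the 2-adic
Kubota–Leopoldt numerator `G = klTwoNumerator` and its involute `G^ι = klTwoNumeratorInv` (D1,
`Literature/…/KubotaLeopoldtTwoNumerator.lean`, val-lit-t14 g9 p541730; its §5 `exists_iwasawa_half_klTwoNumerator(Inv)` =
«`½G, ½G^ι ∈ Λ` with constant term `1`», bsd-rank2-lit GEN 19 p544121, from the EVENNESS of the measure `χ₋₄E_{1,5}` and the
`Δ = {±1}` doubling of the Mazur–Tate–Teitelbaum Riemann sums at `2`): the witnesses are `c = ½`, `G₀ = ½G`, `G₀^ι = ½G^ι`,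
whose unit contents are themselves (`μ = 0`) with constant term `1 mod 2 ≠ 0`. The statement `star_klTwoWitness` is the
line's Prop `KlTwoWitness` UNFOLDED verbatim over tree names, so that in the skeleton `stub_klTwoWitness : KlTwoWitness :=
star_klTwoWitness` (checked: with (E) `star_eulerOrderAtTwo` p542891 and (T) `star_transfer` p543709 the skeleton then
elaborates with exactly ONE `sorry`, the research stub (★_S) `stub_starCongruence`). Nothing here proves (★_S) or bounds
`λ(L₂(E))`; BSD is not proved by any of this. PARTITION (D-0054): none — r_an ≥ 2 axis S0, door T-r3₂.

References: B. Mazur, J. Tate, J. Teitelbaum, Invent. Math. 84 (1986) §I.12–I.13 [MazurTateTeitelbaum1986Invent];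
S. Lang, *Cyclotomic Fields I and II*, Ch. 4 §3 [LangCyclotomic1990]; L. Washington, GTM 83, §7.1–7.2 (`Λ/2Λ = 𝔽₂⟦T⟧`;
at `p = 2` one divides by `2`) [Washington1997].
-/

set_option linter.dupNamespace false
set_option autoImplicit false

noncomputable section

open scoped Classical

open Literature.NumberTheory.EllipticCurves Summit.BirchSwinnertonDyer.Rank1Residual.X1
  Summit.BirchSwinnertonDyer.Rank1Residual.X1.MuLambda

namespace Summit.BirchSwinnertonDyer.BirchSwinnertonDyer.Theorems.DepletionAtTwo

/-! ## §1 Stub (K): the Kubota–Leopoldt witnesses at `2` -/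

/-- An element `G₀ ∈ Λ = ℤ_p⟦T⟧` with constant term `1` is nonzero and its unit content `pfree G₀` (`= G₀`, `μ = 0`) has
nonzero constant term mod `p`. [cite: Washington1997, §7.1 (μ, λ and the unit content of an element of Λ)] -/
theorem ne_zero_and_constantCoeff_red_pfree_ne_zero_of_constantCoeff_eq_one {p : ℕ} [Fact p.Prime]
    {G₀ : IwasawaAlgebra p} (h1 : PowerSeries.constantCoeff G₀ = 1) :
    G₀ ≠ 0 ∧ PowerSeries.constantCoeff (red (pfree G₀)) ≠ 0 := by
  have hred0 : PowerSeries.constantCoeff (red G₀) = 1 := by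
    rw [red, ← PowerSeries.coeff_zero_eq_constantCoeff_apply, PowerSeries.coeff_map,
      PowerSeries.coeff_zero_eq_constantCoeff_apply, h1, map_one]
  have hred : red G₀ ≠ 0 := fun h ↦ by
    rw [h, map_zero] at hred0
    exact zero_ne_one hred0
  have hfac : G₀ = PowerSeries.C (((p : ℕ) : ℤ_[p]) ^ 0) * G₀ := by rw [pow_zero, map_one, one_mul]
  obtain ⟨-, hpf⟩ := mu_eq_and_pfree_eq hred hfac
  refine ⟨?_, ?_⟩
  · rintro rfl
    rw [map_zero] at h1
    exact zero_ne_one h1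
  · rw [hpf, hred0]
    exact one_ne_zero

/-- **STUB (K) `KlTwoWitness` of line `star`, VERBATIM over tree names: the 2-adic Kubota–Leopoldt numerator `G` and its
involute `G^ι` are nonzero scalar multiples of elements of `Λ = ℤ₂⟦T⟧` whose unit contents have nonzero constant term
mod `2`** — witnesses `c = ½`, `G₀ = ½G`, `G₀^ι = ½G^ι` (`exists_iwasawa_half_klTwoNumerator(Inv)`: the measure `χ₋₄E_{1,5}`
is even, so every Mazur–Tate–Teitelbaum Riemann sum at `2` is twice its `η = 1` half, and `G(0) = G^ι(0) = 2`).
[cite: MazurTateTeitelbaum1986Invent, §I.12–I.13 (p = 2: Δ = {±1})] [cite: LangCyclotomic1990, Ch. 4 §3 (PDF p. 84)]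
[cite: Washington1997, §7.2 (p = 2)] -/
theorem star_klTwoWitness :
    (∃ (cg : ℚ_[2]) (G₀ : IwasawaAlgebra 2), G₀ ≠ 0 ∧
        iwasawaToPowerSeries 2 G₀ = PowerSeries.C cg * klTwoNumerator ∧
        PowerSeries.constantCoeff (MuLambda.red (MuLambda.pfree G₀)) ≠ 0) ∧
      (∃ (ci : ℚ_[2]) (GI₀ : IwasawaAlgebra 2), GI₀ ≠ 0 ∧
        iwasawaToPowerSeries 2 GI₀ = PowerSeries.C ci * klTwoNumeratorInv ∧
        PowerSeries.constantCoeff (MuLambda.red (MuLambda.pfree GI₀)) ≠ 0) := by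
  obtain ⟨G₀, hG, h1⟩ := exists_iwasawa_half_klTwoNumerator
  obtain ⟨GI₀, hGI, hI1⟩ := exists_iwasawa_half_klTwoNumeratorInv
  obtain ⟨hG0, hGc⟩ := ne_zero_and_constantCoeff_red_pfree_ne_zero_of_constantCoeff_eq_one h1
  obtain ⟨hGI0, hGIc⟩ := ne_zero_and_constantCoeff_red_pfree_ne_zero_of_constantCoeff_eq_one hI1
  exact ⟨⟨2⁻¹, G₀, hG0, hG, hGc⟩, ⟨2⁻¹, GI₀, hGI0, hGI, hGIc⟩⟩

end Summit.BirchSwinnertonDyer.BirchSwinnertonDyer.Theorems.DepletionAtTwo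

end
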